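import Mathlib
import Summits.NavierStokesRegularity.NavierStokesRegularity.Theorems.OrthantWakeTwinSideBranch
import Summits.NavierStokesRegularity.NavierStokesRegularity.Theorems.OrthantWakeTwinEmbedding
import Summits.NavierStokesRegularity.NavierStokesRegularity.Theorems.OrthantWakeOrthantHopWake.Negative.OrthantHopWakeFalseOfThinResidueStates
import HarnessLib

/-!
# `OrthantWake.ForwardHopWake` (stmt-NavierStokesRegularity-26438) — negative lemma modulo
# THIN-RESIDUE STATES of the side-branch dead-end table `α_SB`

The crux `ForwardHopWake` (R1″) repaired the numerically refuted total-energy ratchet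
`OrthantHopWake` (item 24639; `Theorems/OrthantWakeOrthantHopWake/Negative/…ThinResidueStates.lean`)
by restricting the tail energies to a SYNTACTIC forward-source set `S ⊇ S⁺(α) = {i : ∃ j l,
α i j l (0,0,1) ≠ 0}` chosen per table. This file shows that the repair does not escape the
dead-end mechanism: the all-source orthant table `twin-α_SB ∈ E₂(17)`
(`Theorems/OrthantWakeTwinSideBranch.lean`; every component is a syntactic source, so `S = univ`)
carries, through the exact embedding `twinEmbed` (`Theorems/OrthantWakeTwinEmbedding.lean`), every
solution of the dead-end table `α_SB = SubOnsagerCeiling.sideBranchTable` with the same tails above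
shell `1`. Hence

* `forwardHopWake_imp_totalHop_sideBranchTable` — `ForwardHopWake` implies the TOTAL-energy hop
  ratchet (the conclusion of the aside `OrthantHopWake`) for every regular non-negative viscous
  `α_SB` solution, with the crux's constants at spread `17`;
* `ThinResidueStatesSB` (a `Prop`, NOTHING asserted; implies the tree's `ThinResidueStates`,
  `thinResidueStates_of_SB`) — thin-residue states of `α_SB` at arbitrarily deep shells and small
  scale ratios, the numerically observed parking (`Θ → 5/9`, lead's REFUTATION-EVIDENCE; per-hop
  `W = 0.20–0.47` on the sibling witness `T₁₀`, CENSUS-24639 v3.3);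
* **`forwardHopWake_false_of_thinResidueStatesSB : ThinResidueStatesSB → ¬ ForwardHopWake`**, via
  the tree's `orthantHop_no_hop_of_thinResidueState` and cone invariance (`orthantInvariance_proof`).

(The crux is independently dead on asymmetric 2-cycle pump tables — planner's matrix 4, kit j303295,
per-hop exponent alternating `0.17/3.16`; that mechanism is NOT used here. The present one also
bears on block versions of the ratchet and on the ceiling/envelope cruxes 26608/26373, see the
sibling reduction files.)

HONEST FRAMING: MODEL lattice ODEs only (Tao 2016 §4 vocabulary; rung TL-M2Break); a conditional
refutation plus an implication between open statements; no crux is refuted in the kernel and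
nothing here is a statement about the Navier–Stokes equations.
-/

noncomputable section

-- the sub-problem namespace `NavierStokesRegularity.NavierStokesRegularity` is the tree's layout (D-0017)
set_option linter.dupNamespace false

namespace Summit.NavierStokesRegularity.NavierStokesRegularity.Theorems

open Literature.Analysis.FluidPDE.TaoCascade

/-! ## Reduction 3: `ForwardHopWake` (item 26438) implies the TOTAL-energy hop ratchet on `α_SB`,
hence is refuted by thin-residue states of `α_SB` -/

/-- **The forward-source hop wake implies the total hop ratchet on `α_SB`.** If `ForwardHopWake`
(route OrthantWake, item 26438) holds, then there are `η, κ₁ > 0` and `ε̄ ∈ (0,1]` (those of the crux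
at spread `17`) such that for `ε₀ ≤ ε̄`, every `ν > 0`, every one-shell datum and every regular
`ν`-viscous solution `X` of the `α_SB` lattice on `[0,s]` that is non-negative on shells `≥ 1`:
at every shell `n ≥ κ₁/ε₀` and time `t ≤ s` there is `u ≤ t` with
`T_{n+1}(t) ≤ (1+ε₀)^{-(1+η)} T_n(u)` for the TOTAL tail energies of `X` — the conclusion of the
aside crux `OrthantHopWake` (item 24639, numerically refuted on such dead-end tables) for this table.
Proof: all-source twin table (`S = univ`), exact embedding, and equality of the tails above shell
`n ≥ 1` (`twinEmbed_tail_eq`). MODEL lattice only; an implication between open statements.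
[this file] -/
theorem forwardHopWake_imp_totalHop_sideBranchTable
    (h : Summit.NavierStokesRegularity.NavierStokesRegularity.Theses.OrthantWake.ForwardHopWake) :
    ∃ η : ℝ, 0 < η ∧ ∃ κ₁ : ℝ, 0 < κ₁ ∧ ∃ εbar : ℝ, 0 < εbar ∧ εbar ≤ 1 ∧
      ∀ ε₀ : ℝ, 0 < ε₀ → ε₀ ≤ εbar → ∀ ν : ℝ, 0 < ν →
      ∀ (X₀ : Fin 4 → ℝ) (s : ℝ), 0 < s → ∀ X : Fin 4 → ℤ → ℝ → ℝ,
        (∀ (i : Fin 4) (k : ℤ), X i k 0 = if k = 0 then X₀ i else 0) →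
        (∀ (i : Fin 4) (k : ℤ), k < 0 → ∀ t : ℝ, X i k t = 0) →
        (∃ M : ℝ, ∀ (t : ℝ) (i : Fin 4) (k : ℤ), (1 + (1 + ε₀) ^ ((10 : ℝ) * k)) * |X i k t| ≤ M) →
        (∀ (i : Fin 4) (k : ℤ), Continuous (X i k)) →
        (∀ (i : Fin 4) (k : ℤ), ∀ t ∈ Set.Icc (0 : ℝ) s, HasDerivWithinAt (X i k)
          (quadTerm ε₀ SubOnsagerCeiling.sideBranchTable X i k t -
            ν * (1 + ε₀) ^ ((2 : ℝ) * k) * X i k t) (Set.Icc (0 : ℝ) s) t) →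
        (∀ t ∈ Set.Icc (0 : ℝ) s, ∀ (i : Fin 4) (k : ℤ), 1 ≤ k → 0 ≤ X i k t) →
        ∀ n : ℕ, κ₁ ≤ ε₀ * n → ∀ t ∈ Set.Icc (0 : ℝ) s, ∃ u ∈ Set.Icc (0 : ℝ) t,
          (∑' j : ℕ, ∑ i : Fin 4, (1 / 2 : ℝ) * X i ((n + 1 : ℕ) + (j : ℤ)) t ^ 2) ≤
            (1 + ε₀) ^ (-(1 + η)) * (∑' j : ℕ, ∑ i : Fin 4, (1 / 2 : ℝ) * X i ((n : ℕ) + (j : ℤ)) u ^ 2) := by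
  obtain ⟨η, hη, κ₁, hκ₁, εbar, hεbar, hεbar1, hhop⟩ := h 17 (by norm_num)
  refine ⟨η, hη, κ₁, hκ₁, εbar, hεbar, hεbar1, ?_⟩
  intro ε₀ hε hεle ν hν X₀ s hs X hinit hlow hbd hcont hder hpos n hκn t ht
  obtain ⟨S, hS, hsol⟩ := hhop ε₀ hε hεle ν hν twinSideBranchTable twinSideBranchTable_inTableClass
    twinSideBranchTable_orthant
  have hSu : S = Finset.univ := twinSideBranchTable_allSource S hS
  subst hSu
  obtain ⟨M, hM⟩ := hbd
  obtain ⟨u, hu, hle⟩ := hsol (twinMix X₀) s hs (twinEmbed X) (twinEmbed_init hinit)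
    (twinEmbed_low hlow) ⟨M, twinEmbed_bound hε hM⟩ (twinEmbed_continuous hcont)
    (twinEmbed_hasDerivWithinAt hder) (twinEmbed_nonneg hpos) n hκn t ht
  -- the state sits at a shell `n ≥ 1`
  have hn1 : 1 ≤ n := by
    by_contra h0
    push Not at h0
    interval_cases n
    simp at hκn; linarith
  refine ⟨u, hu, ?_⟩
  rw [twinEmbed_tail_eq hε hν hinit hder (by omega) ht,
    twinEmbed_tail_eq hε hν hinit hder hn1 ⟨hu.1, hu.2.trans ht.2⟩] at hle
  exact hle

/-- **`ThinResidueStatesSB` — the construction hypothesis of the conditional refutation of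
`ForwardHopWake`** (the tree's `ThinResidueStates`, specialised to the side-branch table
`α_SB = SubOnsagerCeiling.sideBranchTable`, which it implies — `thinResidueStates_of_SB`): for every
threshold `ε̄ ∈ (0,1]` there is a scale ratio `1+ε₀ ≤ 1+ε̄` such that for every depth `K` some
viscosity `ν > 0`, some one-shell datum `X₀`, some window `[0,s]` and some regular solution `X` of
the `ν`-viscous `α_SB` lattice on it (vanishing below shell `0`, Tao's (4.5) weight bound, continuous
modes, one-sided derivatives within `[0,s]`) reach, at some shell `n ≥ K` and time `t ∈ [0,s]`, a
THIN-RESIDUE STATE: `T_{n+1}(t) > 0` and `e_n(t) + (E₀ − E(t)) ≤ ε₀ · T_{n+1}(t)`. Numerically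
realised by the dead-end pockets of `α_SB` (lead's `Cruxes/OrthantTailCeiling/REFUTATION-EVIDENCE.md`:
parked tail energy `≍ E₀(1+ε₀)^{-Θn}`, `Θ → 5/9 < 1`, on a band growing as `ν ↓ 0`) and of the
sibling witness `T₁₀` (prover census CENSUS-24639 v3.3: per-hop exponent `0.20–0.47` for
`ε₀ = 1/2 … 1/64`); extrapolated, not computed, as `ε₀ → 0`; a CONSTRUCTION TARGET, not a published
fact (vocabulary: Tao 2016 §4 (4.2)–(4.3), (4.8), Lemma 4.1 (4.5)). A `Prop`; nothing asserted.
[this file] -/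
def ThinResidueStatesSB : Prop :=
  ∀ εbar : ℝ, 0 < εbar → εbar ≤ 1 → ∃ ε₀ : ℝ, 0 < ε₀ ∧ ε₀ ≤ εbar ∧
    ∀ K : ℕ, ∃ ν : ℝ, 0 < ν ∧ ∃ (X₀ : Fin 4 → ℝ) (s : ℝ), 0 < s ∧ ∃ X : Fin 4 → ℤ → ℝ → ℝ,
      (∀ (i : Fin 4) (k : ℤ), X i k 0 = if k = 0 then X₀ i else 0) ∧
      (∀ (i : Fin 4) (k : ℤ), k < 0 → ∀ t : ℝ, X i k t = 0) ∧
      (∃ M : ℝ, ∀ (t : ℝ) (i : Fin 4) (k : ℤ), (1 + (1 + ε₀) ^ ((10 : ℝ) * k)) * |X i k t| ≤ M) ∧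
      (∀ (i : Fin 4) (k : ℤ), Continuous (X i k)) ∧
      (∀ (i : Fin 4) (k : ℤ), ∀ t ∈ Set.Icc (0 : ℝ) s, HasDerivWithinAt (X i k)
        (quadTerm ε₀ SubOnsagerCeiling.sideBranchTable X i k t -
          ν * (1 + ε₀) ^ ((2 : ℝ) * k) * X i k t) (Set.Icc (0 : ℝ) s) t) ∧
      ∃ n : ℕ, K ≤ n ∧ ∃ t ∈ Set.Icc (0 : ℝ) s,
        0 < (∑' j : ℕ, ∑ i : Fin 4, (1 / 2 : ℝ) * X i ((n + 1 : ℕ) + (j : ℤ)) t ^ 2) ∧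
        (∑ i : Fin 4, (1 / 2 : ℝ) * X i (n : ℤ) t ^ 2) +
            ((∑ i : Fin 4, (1 / 2 : ℝ) * X₀ i ^ 2) -
              ∑' j : ℕ, ∑ i : Fin 4, (1 / 2 : ℝ) * X i (j : ℤ) t ^ 2) ≤
          ε₀ * ∑' j : ℕ, ∑ i : Fin 4, (1 / 2 : ℝ) * X i ((n + 1 : ℕ) + (j : ℤ)) t ^ 2

/-- `ThinResidueStatesSB` is a specialisation of the tree's `ThinResidueStates` (spread `10`, the
orthant table `α_SB`). [this file] -/
theorem thinResidueStates_of_SB (hH : ThinResidueStatesSB) : ThinResidueStates := by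
  refine ⟨10, by norm_num, ?_⟩
  intro εbar hεbar hεbar1
  obtain ⟨ε₀, hε₀, hε₀le, hdepth⟩ := hH εbar hεbar hεbar1
  refine ⟨ε₀, hε₀, hε₀le, ?_⟩
  intro K
  obtain ⟨ν, hν, X₀, s, hs, X, hinit, hlow, hbd, hcont, hder, n, hn, t, ht, hT, hthin⟩ := hdepth K
  exact ⟨ν, hν, SubOnsagerCeiling.sideBranchTable, SubOnsagerCeiling.sideBranchTable_inTableClass,
    SubOnsagerCeiling.sideBranchTable_orthant, X₀, s, hs, X, hinit, hlow, hbd, hcont, hder, n, hn, t,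
    ht, hT, hthin⟩

/-- **Negative lemma (conditional refutation of the crux `ForwardHopWake`, item 26438).**
`ThinResidueStatesSB → ¬ ForwardHopWake`: the forward-source hop wake forces the total hop ratchet
on `α_SB` (`forwardHopWake_imp_totalHop_sideBranchTable`), the `α_SB` solution is non-negative on
shells `≥ 1` by cone invariance (`orthantInvariance_proof`, item 24642, with
`sideBranchTable_orthant`), and a thin-residue state at depth `n ≥ ⌈κ₁/ε₀⌉` contradicts the hop at
`(n,t)` for every `u ≤ t` (`orthantHop_no_hop_of_thinResidueState`). MODEL lattice only;
conditional; settles nothing by itself. [this file] -/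
theorem forwardHopWake_false_of_thinResidueStatesSB (hH : ThinResidueStatesSB) :
    ¬ Summit.NavierStokesRegularity.NavierStokesRegularity.Theses.OrthantWake.ForwardHopWake := by
  intro hW
  obtain ⟨η, hη, κ₁, hκ₁, εbar, hεbar, hεbar1, hhop⟩ :=
    forwardHopWake_imp_totalHop_sideBranchTable hW
  obtain ⟨ε₀, hε₀, hε₀le, hdepth⟩ := hH εbar hεbar hεbar1
  obtain ⟨ν, hν, X₀, s, hs, X, hinit, hlow, hbd, hcont, hder, n, hn, t, ht, hT, hthin⟩ :=
    hdepth ⌈κ₁ / ε₀⌉₊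
  have hpos : ∀ t ∈ Set.Icc (0 : ℝ) s, ∀ (i : Fin 4) (k : ℤ), 1 ≤ k → 0 ≤ X i k t :=
    orthantInvariance_proof ε₀ ν hε₀ hν SubOnsagerCeiling.sideBranchTable
      SubOnsagerCeiling.sideBranchTable_orthant X₀ s hs X hinit hlow hbd hcont hder
  have hκn : κ₁ ≤ ε₀ * n := by
    have h1 : κ₁ / ε₀ ≤ (n : ℝ) := (Nat.le_ceil _).trans (by exact_mod_cast hn)
    rw [div_le_iff₀ hε₀] at h1
    linarith
  obtain ⟨M, hM⟩ := hbd
  have hhopn := hhop ε₀ hε₀ hε₀le ν hν X₀ s hs X hinit hlow ⟨M, hM⟩ hcont hder hpos n hκn t ht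
  exact orthantHop_no_hop_of_thinResidueState hε₀ hν hη
    SubOnsagerCeiling.sideBranchTable_cancelling SubOnsagerCeiling.sideBranchTable_orthant hinit hlow
    hM hder hpos ht hT hthin hhopn

end Summit.NavierStokesRegularity.NavierStokesRegularity.Theorems

end
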